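import Literature.Geometry.Riemannian.MetricFlow
import Mathlib.MeasureTheory.Constructions.BorelSpace.Metric
import Mathlib.MeasureTheory.Measure.Prod
import HarnessLib

/-!
# Couplings, the `W₁`-Wasserstein distance, variances of measures, and `H`-concentration of
# metric flows (Bamler 2023, §2.1, §2.2, §3.4)

R. Bamler, *Compactness theory of the space of super Ricci flows*, Invent. Math. 233 (2023).
§2.1: "a coupling between `μ₁, μ₂` is a probability measure `q ∈ 𝒫(X₁ × X₂)` with marginals
`μ₁, μ₂` … Note that `q = μ₁ ⊗ μ₂` is a coupling between `μ₁, μ₂`"; "We recall the definition of the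
`W_p`-Wasserstein distance … `d_{W_p}(μ₁, μ₂) := inf_q (∫_{X×X} d^p(x₁,x₂) dq(x₁,x₂))^{1/p}`, where
the infimum is taken over all couplings `q` … between `μ₁, μ₂`" (allowed to attain the value `∞`).
§2.2, Definition (Variance): "`Var(μ₁, μ₂) := ∫_X ∫_X d²(x₁, x₂) dμ₁(x₁) dμ₂(x₂)` … `Var(μ) = Var(μ, μ)`",
with "`Var(δ_x, μ) = ∫_X d²(x, y) dμ(y)`" and "`Var(δ_x, δ_y) = d²(x, y)`". §3.4, Definition
(`H`-Concentration): "`𝒳` is called `H`-concentrated if for any `s ≤ t`, `s, t ∈ I`, `x₁, x₂ ∈ 𝒳_t`,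
`Var(ν_{x₁;s}, ν_{x₂;s}) ≤ d²_t(x₁, x₂) + H(t − s)`", Remark: "If `s = t`, then we have equality";
Definition (`H`-center): "A point `z ∈ 𝒳_s` is called an `H`-center of some point `x ∈ 𝒳_t` if
`s ≤ t` and `Var(δ_z, ν_{x;s}) ≤ H(t − s)`."

This file vendors these notions as real definitions over Mathlib's measure theory, valued in
`ℝ≥0∞` (the source allows the value `∞`), with the elementary API the source records:

* `IsCoupling μ₁ μ₂ q` (marginals `q.fst = μ₁`, `q.snd = μ₂`, `q` a probability measure);
  `isCoupling_prod` (the product coupling);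
* `wassersteinW1 μ₁ μ₂ = inf_q ∫ d dq` over couplings; `wassersteinW1_le_lintegral` (any coupling
  bounds it), `wassersteinW1_le_lintegral_prod` ("`μ₁ ⊗ μ₂` is a coupling, so `d_{W₁} ≤ ∫∫ d dμ₁dμ₂`");
* `variance μ₁ μ₂ = ∫∫ d² dμ₁ dμ₂`; `variance_dirac_left`, `variance_dirac_dirac`, `variance_comm`;
* `MetricFlow.IsHConcentrated 𝒳 H` — **§3.4, Definition (`H`-Concentration)**; `MetricFlow.variance_condKernel_self` (the
  Remark: equality for `s = t`); `MetricFlow.IsHCenter` — **Definition (`H`-center)**.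

What is NOT here: the Kantorovich–Rubinstein characterisation of `d_{W₁}` (§2.1, Proposition),
the gluing lemma for couplings and the triangle inequality/completeness of `d_{W_p}`, the bounds
`d_{W₁} ≤ √Var ≤ d_{W₁} + √Var(μ₁) + √Var(μ₂)` (§2.2, Lemma), the monotonicity of
`t ↦ Var(μ¹_t, μ²_t) + Ht` along conjugate heat flows of an `H`-concentrated flow (§3.4, Proposition
after the Definition) and the existence of `H`-centers.
-- TODO(general form): `d_{W_p}` for `p ≥ 1` (only `p = 1` is used by the compactness theory).

## References

* R. H. Bamler, *Compactness theory of the space of super Ricci flows*, Invent. Math. 233 (2023),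
  1121–1277 (arXiv:2008.09298), §2.1 (couplings, `d_{W_p}`), §2.2 Definition (Variance) and the
  displays following it, §3.4 Definition (`H`-Concentration), Remark, Definition (`H`-center).
  [Bamler2023]
-/

noncomputable section

open Set MeasureTheory Filter TopologicalSpace
open scoped Topology ENNReal NNReal

namespace Literature.Geometry.Riemannian

universe u v

/-! ### Couplings and the `W₁`-Wasserstein distance -/

section Coupling

variable {X₁ : Type u} {X₂ : Type v} [MeasurableSpace X₁] [MeasurableSpace X₂]

/-- **Coupling** between `μ₁ ∈ 𝒫(X₁)` and `μ₂ ∈ 𝒫(X₂)` (Bamler 2023, §2.1): a probability measure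
`q` on `X₁ × X₂` with marginals `μ₁`, `μ₂` (`Measure.fst`, `Measure.snd`). [cite: Bamler2023, §2.1 (couplings)] -/
def IsCoupling (μ₁ : Measure X₁) (μ₂ : Measure X₂) (q : Measure (X₁ × X₂)) : Prop :=
  IsProbabilityMeasure q ∧ q.fst = μ₁ ∧ q.snd = μ₂

/-- **The product measure is a coupling** ("Note that `q = μ₁ ⊗ μ₂` is a coupling between
`μ₁, μ₂`", Bamler 2023, §2.1). [cite: Bamler2023, §2.1 (couplings)] -/
theorem isCoupling_prod (μ₁ : Measure X₁) (μ₂ : Measure X₂) [IsProbabilityMeasure μ₁]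
    [IsProbabilityMeasure μ₂] : IsCoupling μ₁ μ₂ (μ₁.prod μ₂) :=
  ⟨inferInstance, Measure.fst_prod, Measure.snd_prod⟩

end Coupling

section Wasserstein

variable {X : Type u} [MetricSpace X] [MeasurableSpace X]

/-- **The `W₁`-Wasserstein distance** between two measures on a metric space (Bamler 2023, §2.1,
`p = 1`): `d_{W₁}(μ₁, μ₂) = inf_q ∫_{X×X} d(x₁, x₂) dq(x₁, x₂)` over all couplings `q` between
`μ₁, μ₂`, valued in `[0, ∞]` ("a complete metric on `𝒫(X)` if we allow it to attain the value `∞`";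
the infimum over the empty family, e.g. for non-probability measures, is `∞`).
[cite: Bamler2023, §2.1 (Wasserstein distance)] -/
def wassersteinW1 (μ₁ μ₂ : Measure X) : ℝ≥0∞ :=
  ⨅ q : {q : Measure (X × X) // IsCoupling μ₁ μ₂ q}, ∫⁻ p, edist p.1 p.2 ∂(q : Measure (X × X))

/-- Every coupling bounds the Wasserstein distance: `d_{W₁}(μ₁, μ₂) ≤ ∫ d dq`.
[cite: Bamler2023, §2.1 (Wasserstein distance)] -/
theorem wassersteinW1_le_lintegral {μ₁ μ₂ : Measure X} {q : Measure (X × X)}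
    (hq : IsCoupling μ₁ μ₂ q) : wassersteinW1 μ₁ μ₂ ≤ ∫⁻ p, edist p.1 p.2 ∂q :=
  iInf_le (fun q : {q : Measure (X × X) // IsCoupling μ₁ μ₂ q} ↦
    ∫⁻ p, edist p.1 p.2 ∂(q : Measure (X × X))) ⟨q, hq⟩

/-- **`d_{W₁}(μ₁, μ₂) ≤ ∫∫ d(x₁, x₂) dμ₁(x₁) dμ₂(x₂)`** via the product coupling (Bamler 2023,
§2.2, proof of the Lemma relating `d_{W₁}` and `Var`: "`μ₁ ⊗ μ₂` is a coupling between `μ₁, μ₂`, so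
`d_{W₁}(μ₁, μ₂) ≤ ∫_X ∫_X d(x₁, x₂) dμ₁(x₁) dμ₂(x₂)`"), on a separable metric space with its Borel
σ-algebra (Tonelli). [cite: Bamler2023, §2.2, proof of the Lemma after Definition (Variance)] -/
theorem wassersteinW1_le_lintegral_prod [BorelSpace X] [SeparableSpace X] (μ₁ μ₂ : Measure X)
    [IsProbabilityMeasure μ₁] [IsProbabilityMeasure μ₂] :
    wassersteinW1 μ₁ μ₂ ≤ ∫⁻ x₁, ∫⁻ x₂, edist x₁ x₂ ∂μ₂ ∂μ₁ := by
  haveI : SecondCountableTopology X := UniformSpace.secondCountable_of_separable X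
  refine (wassersteinW1_le_lintegral (isCoupling_prod μ₁ μ₂)).trans_eq ?_
  exact lintegral_prod _ measurable_edist.aemeasurable

end Wasserstein

/-! ### Variances of measures (§2.2) -/

section Variance

variable {X : Type u} [MetricSpace X] [MeasurableSpace X]

/-- **Variance between two measures** on a metric space (Bamler 2023, §2.2, Definition (Variance)):
`Var(μ₁, μ₂) := ∫_X ∫_X d²(x₁, x₂) dμ₁(x₁) dμ₂(x₂)`, as an extended nonnegative real (lower Lebesgue
integrals; the source allows `Var = ∞`). `Var(μ) := Var(μ, μ)` is `variance μ μ`.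
[cite: Bamler2023, §2.2, Definition (Variance)] -/
def variance (μ₁ μ₂ : Measure X) : ℝ≥0∞ :=
  ∫⁻ x₁, ∫⁻ x₂, edist x₁ x₂ ^ 2 ∂μ₂ ∂μ₁

/-- Unfolding of the variance. [cite: Bamler2023, §2.2, Definition (Variance)] -/
theorem variance_def (μ₁ μ₂ : Measure X) :
    variance μ₁ μ₂ = ∫⁻ x₁, ∫⁻ x₂, edist x₁ x₂ ^ 2 ∂μ₂ ∂μ₁ := rfl

variable [BorelSpace X]

/-- **`Var(δ_x, μ) = ∫ d²(x, y) dμ(y)`** (Bamler 2023, §2.2, display after Definition (Variance)).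
[cite: Bamler2023, §2.2, display after Definition (Variance)] -/
theorem variance_dirac_left (x : X) (μ : Measure X) :
    variance (Measure.dirac x) μ = ∫⁻ y, edist x y ^ 2 ∂μ := by
  rw [variance_def, lintegral_dirac]

/-- **`Var(δ_x, δ_y) = d²(x, y)`** (Bamler 2023, §2.2, display after Definition (Variance)).
[cite: Bamler2023, §2.2, display after Definition (Variance)] -/
theorem variance_dirac_dirac (x y : X) :
    variance (Measure.dirac x) (Measure.dirac y) = edist x y ^ 2 := by
  rw [variance_dirac_left, lintegral_dirac]

/-- **Symmetry `Var(μ₁, μ₂) = Var(μ₂, μ₁)`** for s-finite measures on a separable metric space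
(Tonelli and `d(x₁, x₂) = d(x₂, x₁)`; implicit in the source's symmetric use of `Var`).
[cite: Bamler2023, §2.2, Definition (Variance)] -/
theorem variance_comm [SeparableSpace X] (μ₁ μ₂ : Measure X) [SFinite μ₁] [SFinite μ₂] :
    variance μ₁ μ₂ = variance μ₂ μ₁ := by
  haveI : SecondCountableTopology X := UniformSpace.secondCountable_of_separable X
  rw [variance_def, variance_def,
    lintegral_lintegral_swap ((measurable_edist.pow_const 2).aemeasurable)]
  simp_rw [edist_comm]

end Variance

/-! ### `H`-concentration of a metric flow (§3.4) and `H`-centers -/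

namespace MetricFlow

variable {I : Set ℝ}

/-- **`H`-concentration** (Bamler 2023, §3.4, Definition (`H`-Concentration)): a metric flow `𝒳` over `I` is
`H`-concentrated if for all `s ≤ t` in `I` and `x₁, x₂ ∈ 𝒳_t`,
`Var(ν_{x₁;s}, ν_{x₂;s}) ≤ d_t²(x₁, x₂) + H (t − s)`. Here `H ≥ 0` is a real constant (`H = H_n`
for `n`-dimensional super Ricci flows) and both sides are extended nonnegative reals.
[cite: Bamler2023, §3.4, Definition (H-Concentration)] -/
def IsHConcentrated (𝒳 : MetricFlow I) (H : ℝ) : Prop :=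
  ∀ ⦃s t : I⦄, (s : ℝ) ≤ t → ∀ x₁ x₂ : 𝒳.Slice t,
    variance (𝒳.condKernel x₁ s) (𝒳.condKernel x₂ s) ≤
      edist x₁ x₂ ^ 2 + ENNReal.ofReal (H * ((t : ℝ) - s))

/-- Unfolding of `H`-concentration at a pair of points. [cite: Bamler2023, §3.4, Definition (H-Concentration)] -/
theorem IsHConcentrated.variance_le {𝒳 : MetricFlow I} {H : ℝ} (h : 𝒳.IsHConcentrated H)
    {s t : I} (hst : (s : ℝ) ≤ t) (x₁ x₂ : 𝒳.Slice t) :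
    variance (𝒳.condKernel x₁ s) (𝒳.condKernel x₂ s) ≤
      edist x₁ x₂ ^ 2 + ENNReal.ofReal (H * ((t : ℝ) - s)) :=
  h hst x₁ x₂

/-- **Equality at `s = t`** (Bamler 2023, §3.4, Remark after the Definition: "If `s = t`, then we have equality
…, as `Var(δ_{x₁}, δ_{x₂}) = d_t²(x₁, x₂)`"): `Var(ν_{x₁;t}, ν_{x₂;t}) = d_t(x₁, x₂)²` by
item (5) of Def. 3.2. [cite: Bamler2023, §3.4, Remark after Definition (H-Concentration)] -/
theorem variance_condKernel_self (𝒳 : MetricFlow I) {t : I} (x₁ x₂ : 𝒳.Slice t) :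
    variance (𝒳.condKernel x₁ t) (𝒳.condKernel x₂ t) = edist x₁ x₂ ^ 2 := by
  rw [𝒳.condKernel_self, 𝒳.condKernel_self, variance_dirac_dirac]

/-- The `H`-concentration inequality is an equality, hence automatic, for `s = t`
(Remark after the Definition of `H`-concentration). [cite: Bamler2023, §3.4, Remark after Definition (H-Concentration)] -/
theorem variance_condKernel_self_le (𝒳 : MetricFlow I) {H : ℝ} {t : I} (x₁ x₂ : 𝒳.Slice t) :
    variance (𝒳.condKernel x₁ t) (𝒳.condKernel x₂ t) ≤
      edist x₁ x₂ ^ 2 + ENNReal.ofReal (H * ((t : ℝ) - t)) := by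
  rw [𝒳.variance_condKernel_self, sub_self, mul_zero, ENNReal.ofReal_zero, add_zero]

/-- **`H`-center** (Bamler 2023, §3.4, Definition (`H`-center)): `z ∈ 𝒳_s` is an `H`-center of
`x ∈ 𝒳_t` if `s ≤ t` and `Var(δ_z, ν_{x;s}) ≤ H (t − s)`. [cite: Bamler2023, §3.4, Definition (H-center)] -/
def IsHCenter (𝒳 : MetricFlow I) (H : ℝ) {s t : I} (z : 𝒳.Slice s) (x : 𝒳.Slice t) : Prop :=
  (s : ℝ) ≤ t ∧ variance (Measure.dirac z) (𝒳.condKernel x s) ≤ ENNReal.ofReal (H * ((t : ℝ) - s))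

/-- An `H`-center `z` of `x` satisfies `∫ d_s²(z, y) dν_{x;s}(y) ≤ H(t − s)` (`Var(δ_z, ·)` unfolded,
display after Definition (Variance)). [cite: Bamler2023, §3.4, Definition (H-center)] -/
theorem IsHCenter.lintegral_edist_sq_le {𝒳 : MetricFlow I} {H : ℝ} {s t : I} {z : 𝒳.Slice s}
    {x : 𝒳.Slice t} (h : 𝒳.IsHCenter H z x) :
    ∫⁻ y, edist z y ^ 2 ∂(𝒳.condKernel x s) ≤ ENNReal.ofReal (H * ((t : ℝ) - s)) := by
  rw [← variance_dirac_left]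
  exact h.2

/-- Every point is an `H`-center of itself (`H ≥ 0` not even needed: `Var(δ_x, δ_x) = 0`).
[cite: Bamler2023, §3.4, Definition (H-center)] -/
theorem isHCenter_self (𝒳 : MetricFlow I) (H : ℝ) {t : I} (x : 𝒳.Slice t) : 𝒳.IsHCenter H x x := by
  refine ⟨le_rfl, ?_⟩
  rw [𝒳.condKernel_self, variance_dirac_dirac, edist_self, sub_self, mul_zero, ENNReal.ofReal_zero]
  simp

end MetricFlow

end Literature.Geometry.Riemannian

end
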